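import Summits.Langlands.Langlands.Theses.MirrorPairReflection

/-!
# Birth skeleton (BC3) of the crux `SelfMirrorDihedral` (stmt-Langlands-12836)

Route `MirrorPairReflection` (crux rank 4). The crux: `p` odd, `σ : Γ_ℚ → GL₂(ℚ̄_p)` continuous,
unramified outside `p`, residual type `(a,b)` by traces with `a+b` even and self-mirror index
`(b−a) ≡ (p−1)/2 (mod p−1)`, `p ∣ B_{(p−1)/2}` (an Ankeny–Artin–Chowla failure), `σ` irreducible
⟹ `σ` is diagonal on `Γ_{ℚ(√p)} = {g : g • r = r}`, `r² = p` (i.e. `σ ≅ Ind` from `ℚ(√p)`).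

The line (refuter crux-attack analysis on the item, EVIDENCE.md §6, sharpened): twist `a = 0`;
on `K = ℚ(√p)` the residual type COLLAPSES to a scalar (`ω^{(p−1)/2}|_{Γ_K} = 1`, Gauss), so
`σ|_{Γ_K} ⊗ ω^{−a}` is pro-`p` and factors through `𝒫 = G_{K,{𝔭}}(p)`, a 2-generator 1-relator
pro-`p` group at an AAC prime (`𝒫^{ab} ≅ ℤ_p ⊕ ℤ/p^s`). `𝒫 ≅ ℤ_p ⋉ ℤ_p` iff the Iwasawa
invariant `λ` of the irregular pair `(p, (p−1)/2)` equals `1` iff the second-order Kummer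
congruence FAILS: `B_j/j ≢ B_{3j}/(3j) (mod p²)`, `j = (p−1)/2` (note `j + (p−1) = 3j`); in that
case an elementary `GL₂` lemma (`ABA⁻¹ = B^q` with `A`, `B` residually unipotent forces `[A,B]=1`
or a unique common eigenline, which `τ`-normality makes `Γ_ℚ`-stable) gives `σ(Γ_K)` ABELIAN; the
regime `λ ≥ 2` is the honest open residue. Clifford theory for the index-2 normal subgroup `Γ_K`
turns "abelian on `Γ_K`" into "diagonal on `Γ_K`" for irreducible `σ`.

Stubs (four, each a genuine lemma of the line):
* `stub_traceCollapseOnQuadratic` — KNOWN (size M): the self-mirror hypotheses force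
  `p ≡ 1 (mod 4)`, `ℚ(√p) ⊂ ℚ(μ_p)` is the fixed field of the squares (Gauss sum), hence
  `χ_p(g)^{(p−1)/2} ≡ 1 (mod p)` for `g` fixing `√p` and the residual traces on `Γ_{ℚ(√p)}` are
  `2·χ_p^a` (ultrametric inequality in `ℚ̄_p`).
* `stub_commuteOnQuadratic_lambdaOne` — the Demuškin/metabelian regime (`λ = 1`, typed as the
  failure of the mod-`p²` Kummer congruence): `σ(Γ_{ℚ(√p)})` is abelian. Provable on paper
  (class field theory of `ℚ(√p)`, `X_S(K_∞) = 𝔛(ω^{(p−1)/2}) ≅ ℤ_p^λ` by Mazur–Wiles +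
  Ferrero–Washington, pro-`p` group theory, the `GL₂` lemma); size XL in Lean.
* `stub_commuteOnQuadratic_lambdaTwo` — the OPEN residue (`λ ≥ 2`, the congruence holds): same
  conclusion. No prime is known in this regime (every tabulated irregular pair has `λ = 1`,
  `p < 2^31`; no AAC failure `< 2·10^11`).
* `stub_diagonalOnQuadraticOfCommute` — KNOWN (size M): Clifford theory for the index-2 normal
  subgroup `Γ_{ℚ(√p)}` (`√p ∉ ℚ`): an irreducible `σ` abelian on it is diagonal on it in some
  frame (a commuting family in `GL₂(ℚ̄_p)` has a common eigenline; if it is the unique stable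
  line it is `Γ_ℚ`-stable by normality, contradicting irreducibility; else two lines diagonalise).

Composition `SelfMirrorDihedral_of (hCollapse : _Goal.stub_traceCollapseOnQuadratic) … : SelfMirrorDihedral`
(hypotheses = the stub statements BY NAME, `_Goal.stub_x := type_of% @stub_x`; real proof, no `sorry`): pick `r` with `r² = p` in `ℚ̄`
(`IsAlgClosed.exists_pow_nat_eq`), collapse the traces on `Stab r` (stub 1), split on the
mod-`p²` Kummer congruence and get commutativity on `Stab r` (stub 2 or stub 3), diagonalise
(stub 4). Sorries: exactly four, one per `stub_*`.
-/

set_option linter.dupNamespace false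
set_option linter.unusedVariables false

open scoped Matrix
open Literature.NumberTheory.GaloisRepresentations

namespace Summit.Langlands.Langlands.Cruxes.SelfMirrorDihedral.Birth

/-! ## Registered stubs -/

/-- STUB 1 — trace collapse on the real quadratic field (KNOWN, size M): under the self-mirror
hypotheses (`a+b` even, `(p−1) ∤ (b−a)`, `(p−1) ∣ 2(b−a)`, so `p ≡ 1 (mod 4)` and
`b − a = (p−1)/2 · odd`), for every square root `r` of `p` in `ℚ̄` and every `g ∈ Γ_ℚ` fixing `r`
one has `χ_p(g)^{(p−1)/2} ≡ 1 (mod p)` (`ℚ(√p)` is the fixed field of the squares in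
`Gal(ℚ(μ_p)/ℚ)`: Gauss sum `√p = Σ (a/p) ζ^a` for `p ≡ 1 (4)`), hence `χ_p(g)^b ≡ χ_p(g)^a` and the
residual trace condition becomes `‖tr σ(g) − 2 χ_p(g)^a‖ < 1` (ultrametric inequality for the
spectral norm on `ℚ̄_p`). [cite: Washington1997, Lemma 4.7 and §6.1] [folklore] -/
theorem stub_traceCollapseOnQuadratic :
    ∀ (p : ℕ) [Fact p.Prime], p ≠ 2 →
      ∀ (σ : FramedGaloisRep ℚ (PadicAlgCl p) 2) (a b : ℕ),
        Even (a + b) → ¬ ((p : ℤ) - 1 ∣ (b : ℤ) - a) → ((p : ℤ) - 1 ∣ 2 * ((b : ℤ) - a)) →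
        (∀ g : Field.absoluteGaloisGroup ℚ, ‖FramedRep.trace σ g -
          ((algebraMap ℚ_[p] (PadicAlgCl p)
              (((GaloisRep.cyclotomicCharacter ℚ p g : ℤ_[p]ˣ) : ℤ_[p]) : ℚ_[p])) ^ a +
            (algebraMap ℚ_[p] (PadicAlgCl p)
              (((GaloisRep.cyclotomicCharacter ℚ p g : ℤ_[p]ˣ) : ℤ_[p]) : ℚ_[p])) ^ b)‖ < 1) →
        ∀ r : AlgebraicClosure ℚ, r ^ 2 = (p : AlgebraicClosure ℚ) →
          ∀ g : Field.absoluteGaloisGroup ℚ, g • r = r →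
            ‖FramedRep.trace σ g - 2 * (algebraMap ℚ_[p] (PadicAlgCl p)
              (((GaloisRep.cyclotomicCharacter ℚ p g : ℤ_[p]ˣ) : ℤ_[p]) : ℚ_[p])) ^ a‖ < 1 := by
  sorry

/-- STUB 2 — rigidity in the metabelian regime `λ = 1` (provable on paper, size XL): all the crux
hypotheses, a square root `r` of `p`, the collapsed trace condition on `Stab r = Γ_{ℚ(√p)}`, and
the FAILURE of the second-order Kummer congruence `B_j/j ≡ B_{3j}/(3j) (mod p²)`, `j = (p−1)/2`
(⟺ the Iwasawa `λ`-invariant of the irregular pair `(p, j)` is `1` ⟺ the maximal pro-`p`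
quotient `𝒫` of `G_{ℚ(√p),{𝔭}}` is `ℤ_p ⋉ ℤ_p`) ⟹ `σ(Γ_{ℚ(√p)})` is abelian. Mechanism: the twist
`σ|_{Γ_K} ⊗ ω^{−a}` is pro-`p` (stub 1), factors through `𝒫 = ⟨x⟩ ⋉ ⟨y⟩`, `x y x⁻¹ = y^q`; for
residually unipotent `A = σ(x)`, `B = σ(y)` the relation forces `B_ss` of `p`-power order and then
either `[A, B] = 1` or a unique common eigenline, which is `Γ_ℚ`-stable because `Γ_K ⊲ Γ_ℚ`,
contradicting irreducibility. Vacuous where `p ∤ B_j` (`𝒫 ≅ ℤ_p`).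
[cite: Washington1997, Thm 7.10 and §13] [cite: AnkenyArtinChowla1952] [folklore] -/
theorem stub_commuteOnQuadratic_lambdaOne :
    ∀ (p : ℕ) [Fact p.Prime], p ≠ 2 →
      ∀ (σ : FramedGaloisRep ℚ (PadicAlgCl p) 2) (a b : ℕ),
        (∀ v : IsDedekindDomain.HeightOneSpectrum (NumberField.RingOfIntegers ℚ),
          ((p : ℕ) : NumberField.RingOfIntegers ℚ) ∉ v.asIdeal → σ.IsUnramifiedAt v) →
        Even (a + b) → ¬ ((p : ℤ) - 1 ∣ (b : ℤ) - a) → ((p : ℤ) - 1 ∣ 2 * ((b : ℤ) - a)) →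
        (∀ g : Field.absoluteGaloisGroup ℚ, ‖FramedRep.trace σ g -
          ((algebraMap ℚ_[p] (PadicAlgCl p)
              (((GaloisRep.cyclotomicCharacter ℚ p g : ℤ_[p]ˣ) : ℤ_[p]) : ℚ_[p])) ^ a +
            (algebraMap ℚ_[p] (PadicAlgCl p)
              (((GaloisRep.cyclotomicCharacter ℚ p g : ℤ_[p]ˣ) : ℤ_[p]) : ℚ_[p])) ^ b)‖ < 1) →
        ((p : ℤ) ∣ (bernoulli ((p - 1) / 2)).num) →
        ¬ ((p : ℤ) ^ 2 ∣ (bernoulli ((p - 1) / 2) / (((p - 1) / 2 : ℕ) : ℚ) -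
            bernoulli (3 * ((p - 1) / 2)) / ((3 * ((p - 1) / 2) : ℕ) : ℚ)).num) →
        FramedRep.IsIrreducible σ →
        ∀ r : AlgebraicClosure ℚ, r ^ 2 = (p : AlgebraicClosure ℚ) →
          (∀ g : Field.absoluteGaloisGroup ℚ, g • r = r →
            ‖FramedRep.trace σ g - 2 * (algebraMap ℚ_[p] (PadicAlgCl p)
              (((GaloisRep.cyclotomicCharacter ℚ p g : ℤ_[p]ˣ) : ℤ_[p]) : ℚ_[p])) ^ a‖ < 1) →
          ∀ g h : Field.absoluteGaloisGroup ℚ, g • r = r → h • r = r →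
            σ g * σ h = σ h * σ g := by
  sorry

/-- STUB 3 — rigidity in the OPEN regime `λ ≥ 2` (the honest open residue of the crux): the same
hypotheses but with the second-order Kummer congruence `B_j/j ≡ B_{3j}/(3j) (mod p²)` HOLDING
(`𝒫 = G_{ℚ(√p),{𝔭}}(p)` is 2-generator 1-relator but not metabelian-by-construction; an even
open-image `σ` would need `𝒫 ↠` an open pro-`p` subgroup of `SL₂(ℤ_p)`) ⟹ `σ(Γ_{ℚ(√p)})` is
abelian. No prime is known in this regime (every irregular pair with `p < 2^31` has `λ = 1`,
Hart–Harvey–Ong 2017; no Ankeny–Artin–Chowla failure below `2·10^11`).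
[cite: HartHarveyOng2017, §1] [cite: VanderpoortenTerieleWilliams2000] [folklore] -/
theorem stub_commuteOnQuadratic_lambdaTwo :
    ∀ (p : ℕ) [Fact p.Prime], p ≠ 2 →
      ∀ (σ : FramedGaloisRep ℚ (PadicAlgCl p) 2) (a b : ℕ),
        (∀ v : IsDedekindDomain.HeightOneSpectrum (NumberField.RingOfIntegers ℚ),
          ((p : ℕ) : NumberField.RingOfIntegers ℚ) ∉ v.asIdeal → σ.IsUnramifiedAt v) →
        Even (a + b) → ¬ ((p : ℤ) - 1 ∣ (b : ℤ) - a) → ((p : ℤ) - 1 ∣ 2 * ((b : ℤ) - a)) →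
        (∀ g : Field.absoluteGaloisGroup ℚ, ‖FramedRep.trace σ g -
          ((algebraMap ℚ_[p] (PadicAlgCl p)
              (((GaloisRep.cyclotomicCharacter ℚ p g : ℤ_[p]ˣ) : ℤ_[p]) : ℚ_[p])) ^ a +
            (algebraMap ℚ_[p] (PadicAlgCl p)
              (((GaloisRep.cyclotomicCharacter ℚ p g : ℤ_[p]ˣ) : ℤ_[p]) : ℚ_[p])) ^ b)‖ < 1) →
        ((p : ℤ) ∣ (bernoulli ((p - 1) / 2)).num) →
        ((p : ℤ) ^ 2 ∣ (bernoulli ((p - 1) / 2) / (((p - 1) / 2 : ℕ) : ℚ) -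
            bernoulli (3 * ((p - 1) / 2)) / ((3 * ((p - 1) / 2) : ℕ) : ℚ)).num) →
        FramedRep.IsIrreducible σ →
        ∀ r : AlgebraicClosure ℚ, r ^ 2 = (p : AlgebraicClosure ℚ) →
          (∀ g : Field.absoluteGaloisGroup ℚ, g • r = r →
            ‖FramedRep.trace σ g - 2 * (algebraMap ℚ_[p] (PadicAlgCl p)
              (((GaloisRep.cyclotomicCharacter ℚ p g : ℤ_[p]ˣ) : ℤ_[p]) : ℚ_[p])) ^ a‖ < 1) →
          ∀ g h : Field.absoluteGaloisGroup ℚ, g • r = r → h • r = r →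
            σ g * σ h = σ h * σ g := by
  sorry

/-- STUB 4 — Clifford theory for the index-two normal subgroup `Γ_{ℚ(√p)}` (KNOWN, size M): if
`σ : Γ_ℚ → GL₂(ℚ̄_p)` is irreducible, `r² = p` (so `r ∉ ℚ` and `Stab r = Γ_{ℚ(r)}` is normal of
index `2`), and `σ` is abelian on `Stab r`, then `σ` is diagonal on `Stab r` in some frame: a
commuting family in `GL₂` over an algebraically closed field has a common eigenline `L`; if `L` is
the only `σ(Stab r)`-stable line then `σ(g)L` (stable under `σ(g · Stab r · g⁻¹) = σ(Stab r)`)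
equals `L` for all `g`, so `L` is `Γ_ℚ`-stable, contradicting irreducibility; otherwise two
distinct stable lines give the diagonalising frame `P`. [folklore] -/
theorem stub_diagonalOnQuadraticOfCommute :
    ∀ (p : ℕ) [Fact p.Prime] (σ : FramedGaloisRep ℚ (PadicAlgCl p) 2),
      FramedRep.IsIrreducible σ →
        ∀ r : AlgebraicClosure ℚ, r ^ 2 = (p : AlgebraicClosure ℚ) →
          (∀ g h : Field.absoluteGaloisGroup ℚ, g • r = r → h • r = r →
            σ g * σ h = σ h * σ g) →
          ∃ P : Matrix.GeneralLinearGroup (Fin 2) (PadicAlgCl p),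
            ∀ g : Field.absoluteGaloisGroup ℚ, g • r = r →
              ((P * σ g * P⁻¹ : Matrix.GeneralLinearGroup (Fin 2) (PadicAlgCl p)) :
                  Matrix (Fin 2) (Fin 2) (PadicAlgCl p)) 0 1 = 0 ∧
              ((P * σ g * P⁻¹ : Matrix.GeneralLinearGroup (Fin 2) (PadicAlgCl p)) :
                  Matrix (Fin 2) (Fin 2) (PadicAlgCl p)) 1 0 = 0 := by
  sorry

/-! ## The stub statements as named propositions (the composition's hypotheses, by name)

`_Goal` is an internal name on purpose: audits listing this file's declarations by short name find the
`stub_*` THEOREMS, while `ledger skeleton check` accepts the hypotheses of `SelfMirrorDihedral_of` by the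
stub names they carry. Each `_Goal.stub_x` is `type_of% @stub_x` — no text is duplicated and no `sorry`
is inherited. -/

namespace _Goal

/-- The statement of `stub_traceCollapseOnQuadratic`, as a named `Prop` (literally its type). [folklore] -/
def stub_traceCollapseOnQuadratic : Prop :=
  type_of% @Summit.Langlands.Langlands.Cruxes.SelfMirrorDihedral.Birth.stub_traceCollapseOnQuadratic

/-- The statement of `stub_commuteOnQuadratic_lambdaOne`, as a named `Prop` (literally its type). [folklore] -/
def stub_commuteOnQuadratic_lambdaOne : Prop :=
  type_of% @Summit.Langlands.Langlands.Cruxes.SelfMirrorDihedral.Birth.stub_commuteOnQuadratic_lambdaOne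

/-- The statement of `stub_commuteOnQuadratic_lambdaTwo`, as a named `Prop` (literally its type). [folklore] -/
def stub_commuteOnQuadratic_lambdaTwo : Prop :=
  type_of% @Summit.Langlands.Langlands.Cruxes.SelfMirrorDihedral.Birth.stub_commuteOnQuadratic_lambdaTwo

/-- The statement of `stub_diagonalOnQuadraticOfCommute`, as a named `Prop` (literally its type). [folklore] -/
def stub_diagonalOnQuadraticOfCommute : Prop :=
  type_of% @Summit.Langlands.Langlands.Cruxes.SelfMirrorDihedral.Birth.stub_diagonalOnQuadraticOfCommute

end _Goal

/-! ## The composition (sorry-free) -/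

/-- COMPOSITION: the four stub statements (by name) imply the crux `SelfMirrorDihedral` (route decl,
by name). Pick a square root `r` of `p` in `ℚ̄` (algebraically closed), collapse the residual traces
on `Stab r` (stub 1), obtain commutativity of `σ` on `Stab r` from stub 2 or stub 3 according to
the mod-`p²` Kummer congruence (classical case split), and diagonalise on `Stab r` (stub 4).
[folklore] -/
theorem SelfMirrorDihedral_of
    (hCollapse : _Goal.stub_traceCollapseOnQuadratic)
    (hLambdaOne : _Goal.stub_commuteOnQuadratic_lambdaOne)
    (hLambdaTwo : _Goal.stub_commuteOnQuadratic_lambdaTwo)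
    (hDiag : _Goal.stub_diagonalOnQuadraticOfCommute) :
    Summit.Langlands.Langlands.Theses.MirrorPairReflection.SelfMirrorDihedral := by
  intro p _ hp σ a b hU hE hnd hd hT hB hI
  -- a square root of `p` in the algebraically closed field `ℚ̄`
  obtain ⟨r, hr⟩ : ∃ r : AlgebraicClosure ℚ, r ^ 2 = (p : AlgebraicClosure ℚ) :=
    IsAlgClosed.exists_pow_nat_eq _ (by norm_num)
  -- stub 1: the residual traces collapse to `2 χ^a` on `Stab r = Γ_{ℚ(√p)}`
  have hcol := hCollapse p hp σ a b hE hnd hd hT r hr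
  -- stubs 2/3: `σ` is abelian on `Stab r`, by the regime of the Kummer congruence
  have hcomm : ∀ g h : Field.absoluteGaloisGroup ℚ, g • r = r → h • r = r →
      σ g * σ h = σ h * σ g := by
    by_cases hK : ((p : ℤ) ^ 2 ∣ (bernoulli ((p - 1) / 2) / (((p - 1) / 2 : ℕ) : ℚ) -
        bernoulli (3 * ((p - 1) / 2)) / ((3 * ((p - 1) / 2) : ℕ) : ℚ)).num)
    · exact hLambdaTwo p hp σ a b hU hE hnd hd hT hB hK hI r hr hcol
    · exact hLambdaOne p hp σ a b hU hE hnd hd hT hB hK hI r hr hcol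
  -- stub 4: Clifford theory on the index-two subgroup
  obtain ⟨P, hP⟩ := hDiag p σ hI r hr hcomm
  exact ⟨P, r, hr, hP⟩

/-- By-name sanity check (an `example`, not a declaration of the file): the four stubs feed the
composition as they stand. -/
example : Summit.Langlands.Langlands.Theses.MirrorPairReflection.SelfMirrorDihedral :=
  SelfMirrorDihedral_of stub_traceCollapseOnQuadratic stub_commuteOnQuadratic_lambdaOne
    stub_commuteOnQuadratic_lambdaTwo stub_diagonalOnQuadraticOfCommute

end Summit.Langlands.Langlands.Cruxes.SelfMirrorDihedral.Birth
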